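import Summits.BirchSwinnertonDyer.BirchSwinnertonDyer.Theorems.ByReductionTypeAtTwoRankOneAtTwoBigImageOddLocalOneDoorHalvesJointDoor
import Literature.NumberTheory.EllipticCurves.SecondDescentShaExponentProofs
import Summits.BirchSwinnertonDyer.Uniform.U2.TransportA
import HarnessLib

/-!
# Route ByReductionTypeAtTwo, crux `RankOneAtTwoBigImageOddLocal` (stmt-BirchSwinnertonDyer-23715), LINE v8.6 `one_door_analytic`:
# the `2`-Selmer BUDGET of a door datum — the BSD-free, kernel-exact falsifier of the child U

Width prover seat `bsd-line-fkl-p2` g9 (2026-08-28), `--supports stmt-BirchSwinnertonDyer-23715`.  THEOREMS ONLY; nothing is asserted;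
BSD is not proved by any of this.

`selmerTwo_budget_of_doorIndexLawUpperCAtTwo_at`: AN-28c-U (`DoorIndexLawUpperCAtTwo`, the Euler-system half-child of 23715) implies, at
every door datum of a slice curve and for every exact `2`-divisibility exponent `m` of the Heegner point, modulo Gross–Zagier, Kolyvagin,
GZK and modularity only:

    ord₂ #Sel₂(W) + ord₂ #Sel₂(Wd) + t + 2s + 2·v₂(c) ≤ 2m + [Δ_W<0] + 1.

Ingredients: the exact descent count `2^{rk}·#E(ℚ)[2]·#Ш[2] = #Sel₂` (`pow_mordellWeilRank_mul_natCard_torsionBy_mul_natCard_shaTorsionBy_eq`,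
Silverman X.4.2) with `rk E(ℚ) = 1`, `rk E^{(d)}(ℚ) = 0` (GZK / pair ledger), `E(ℚ)[2] = E^{(d)}(ℚ)[2] = 0` (odd torsion, twist invariance),
and `#Ш[2] ∣ #Ш[2^∞]`.  Every term except `m` is a 2-descent / door count; `m` is the Heegner-point computation.  This is the census
row of the U child that presupposes nothing open — run by REF1 §109 on ENGINE S (0 violations / 1600 certified door data, 1565 with
equality).  A violating certified row refutes U (and hence `BSD₂` somewhere on the slice or at a twin, by `…OneDoorHalvesJointTwin.lean`).

References: [SilvermanAEC2009] Thm. X.4.2; [GrossLMS1991] §2 Conj. (2.2); [Kramer1981] Prop. 3; [Miller2011LMS] Def. 1.1.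
-/

set_option autoImplicit false
-- the Theorems namespace of this sub repeats the summit name by design (D-0017 nested layout)
set_option linter.dupNamespace false

noncomputable section

open scoped Classical AddSubgroup

namespace Summit.BirchSwinnertonDyer.BirchSwinnertonDyer.Theorems.RankOneAtTwoOneDoor

open WeierstrassCurve NumberField Literature.NumberTheory.EllipticCurves Literature.NumberTheory.EllipticCurves.ModularForms
  Literature.NumberTheory.EllipticCurves.Rank1Residual
  Literature.NumberTheory.EllipticCurves.Rank1Residual.Typed
  Literature.NumberTheory.EllipticCurves.KrizLi2019
  Summit.BirchSwinnertonDyer.Rank1Residual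
  Summit.BirchSwinnertonDyer.Rank1Residual.AdditivePotMult
  Summit.BirchSwinnertonDyer.Rank1Residual.F1Sign2
  Summit.BirchSwinnertonDyer.Rank1Residual.F1Sign2.TranspositionDoor
  Summit.BirchSwinnertonDyer.BirchSwinnertonDyer.Theses.ByReductionTypeAtTwo
  Summit.BirchSwinnertonDyer.BirchSwinnertonDyer.Theorems.CMExactDescent
  Summit.BirchSwinnertonDyer.BirchSwinnertonDyer.Theorems.SchneiderFree.Upper

/-! ### §13 The BSD-free, census-facing FALSIFIER of U in `2`-Selmer currency -/

/-- `A[2] ≤ A[2^∞]`. [folklore] -/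
private theorem torsionBy_two_le_primaryComponent {A : Type*} [AddCommGroup A] :
    A[(2 : ℤ)] ≤ AddCommGroup.primaryComponent A 2 := fun _ hx =>
  (AddCommGroup.mem_primaryComponent).mpr ⟨1, by rw [pow_one]; exact AddSubgroup.torsionBy.nsmul_iff.mp hx⟩

/-- **THE `2`-SELMER BUDGET OF A DOOR DATUM — a BSD-free, kernel-exact necessary condition of AN-28c-U.**  For `W` on the slice (non-CM,
`ρ_{W,2^n}` onto, odd torsion, odd Tamagawa, analytic rank `1`), a door-admissible `K` with `L(W^{(d_K)},1) ≠ 0`, ANY datum `Dt`, the Heegner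
point `P`, a globally minimal twin `Wd`, and every exact `2`-divisibility exponent `m` of `P`; modulo Gross–Zagier / Kolyvagin at
`(N_E, W, K)`, GZK and modularity: U (`DoorIndexLawUpperCAtTwo`) implies
`ord₂ #Sel₂(W) + ord₂ #Sel₂(Wd) + t + 2s + 2·v₂(c) ≤ 2m + [Δ_W<0] + 1`.
(Descent count `2^{rk}·#E(ℚ)[2]·#Ш[2] = #Sel₂` with `rk = 1, 0`, `E(ℚ)[2] = Wd(ℚ)[2] = 0`, and `#Ш[2] ∣ #Ш[2^∞]`.)  Every quantity on the
left is a finite computation (2-descent, the door's prime counts, the constant) and `m` is the Heegner-point computation — the row-by-row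
test of the U child that presupposes nothing open (run by REF1 §99/§109 on ENGINE S: 0 violations / 1600 door data).  Conditional on U by
design; BSD is not proved by this. [cite: SilvermanAEC2009, Thm. X.4.2] [cite: GrossLMS1991, §2 Conj. (2.2)] [cite: Miller2011LMS, Def. 1.1] -/
theorem selmerTwo_budget_of_doorIndexLawUpperCAtTwo_at
    (hGZK : rank_eq_analyticRank_of_analyticRank_le_one) (hnf : exists_isNewformOf) (hU : DoorIndexLawUpperCAtTwo)
    (W : WeierstrassCurve ℚ) [W.IsElliptic] [W.IsGloballyMinimal] [NeZero (W.conductorNorm ℤ)]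
    (hCM : ¬ W.HasCM) (hsurj : ∀ n : ℕ, W.HasSurjectiveModNGaloisRep ((2 ^ n : ℕ) : ℤ)) (hT : Odd W.torsionOrder)
    (hc : Odd W.tamagawaProduct) (hr : W.analyticRank = 1)
    (K : Type) [Field K] [NumberField K] (hK : IsImaginaryQuadratic K)
    (hGZ : gross_zagier (W.conductorNorm ℤ) W K) (hKo : kolyvagin (W.conductorNorm ℤ) W K)
    (hadm : DoorAdmissible W (NumberField.discr K))
    (hLt : (W.quadraticTwist (NumberField.discr K : ℚ)).entireLFunction 1 ≠ 0)
    (Dt : ModularParametrizationData W (W.conductorNorm ℤ))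
    (H : HeegnerDatum (W.conductorNorm ℤ) (NumberField.discr K)) (ι : K →+* ℂ)
    (P : (W.baseChange K).toAffine.Point)
    (hP : WeierstrassCurve.Affine.Point.map ι.toRatAlgHom P = heegnerPointComplex Dt H)
    (Wd : WeierstrassCurve ℚ) [Wd.IsElliptic] [Wd.IsGloballyMinimal] (Cd : VariableChange ℚ)
    (hWd : Cd • W.quadraticTwist (NumberField.discr K : ℚ) = Wd)
    (m : ℕ) (hm : HasTwoDivisibilityUpToTorsion W K P m) :
    padicValNat 2 (Nat.card (W.selmerGroup 2)) + padicValNat 2 (Nat.card (Wd.selmerGroup 2)) +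
        transpCount W (NumberField.discr K) + 2 * identCount W (NumberField.discr K) + 2 * padicValInt 2 Dt.c ≤
      2 * m + (if W.Δ < 0 then 1 else 0) + 1 := by
  haveI : Fact (Nat.Prime 2) := ⟨Nat.prime_two⟩
  have hmod : hasEntireLFunction_rat := hasEntireLFunction_rat_of_exists_isNewformOf hnf
  -- the U inequality at this datum
  have hineq := hU W hCM hsurj hT hc hr K hK hadm hLt Dt H ι P hP Wd Cd hWd m hm
  -- ranks and finiteness
  obtain ⟨hfinW, hfinD, hrd, -⟩ := doorPairLedger_package_at W hT hc hr K hK hGZ hKo hadm hLt Dt H ι P hP Wd Cd hWd hnf hGZK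
  haveI := hfinW
  haveI := hfinD
  obtain ⟨hrkW, -⟩ := hGZK W hr.le
  have hrQ : W.mordellWeilRank = 1 := by rw [hrkW, hr]
  obtain ⟨hrkD, -⟩ := hGZK Wd (by rw [hrd]; exact zero_le_one)
  have hrQd : Wd.mordellWeilRank = 0 := by rw [hrkD, hrd]
  -- no rational `2`-torsion on either side
  have hT2 : NoRationalTwoTorsion W := noRationalTwoTorsion_of_odd_torsionOrder W hT
  have hW2 : W.toAffine.Point[(2 : ℤ)] = ⊥ :=
    Summit.BirchSwinnertonDyer.Uniform.U2.torsionBy_two_eq_bot_iff.mpr (EggDoubling.eq_zero_of_two_smul_eq_zero W hT2)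
  have hD0 : (NumberField.discr K : ℚ) ≠ 0 := by exact_mod_cast NumberField.discr_ne_zero K
  have hWd2 : Wd.toAffine.Point[(2 : ℤ)] = ⊥ :=
    Summit.BirchSwinnertonDyer.Uniform.U2.torsionBy_two_eq_bot_of_twist W hD0 Wd ⟨Cd⁻¹, by rw [← hWd, inv_smul_smul]⟩ hW2
  -- the descent counts `2 · #Ш(W)[2] = #Sel₂(W)`, `#Ш(Wd)[2] = #Sel₂(Wd)` (the tree's count is stated over a generic number field, whose
  -- point-group instance is the classical one; `convert` bridges the `DecidableEq ℚ` instances)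
  have hptW : Nat.card ↥(W.toAffine.Point[(2 : ℤ)]) = 1 := by rw [hW2]; exact AddSubgroup.card_bot
  have hptD : Nat.card ↥(Wd.toAffine.Point[(2 : ℤ)]) = 1 := by rw [hWd2]; exact AddSubgroup.card_bot
  have hselW := W.pow_mordellWeilRank_mul_natCard_torsionBy_mul_natCard_shaTorsionBy_eq (n := 2) two_ne_zero
  have hselD := Wd.pow_mordellWeilRank_mul_natCard_torsionBy_mul_natCard_shaTorsionBy_eq (n := 2) two_ne_zero
  simp only [Nat.cast_ofNat] at hselW hselD
  rw [hrQ, pow_one] at hselW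
  rw [hrQd, pow_zero] at hselD
  have hselW2 : 2 * Nat.card (W.sha[(2 : ℤ)]) = Nat.card (W.selmerGroup 2) := by
    have h1 : 2 * 1 * Nat.card (W.sha[(2 : ℤ)]) = Nat.card (W.selmerGroup 2) := by
      convert hselW using 3
      convert hptW.symm using 10
    simpa using h1
  have hselD2 : Nat.card (Wd.sha[(2 : ℤ)]) = Nat.card (Wd.selmerGroup 2) := by
    have h1 : 1 * 1 * Nat.card (Wd.sha[(2 : ℤ)]) = Nat.card (Wd.selmerGroup 2) := by
      convert hselD using 3
      convert hptD.symm using 10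
    simpa using h1
  -- `#Ш[2] ∣ #Ш[2^∞]`
  haveI : Finite (AddCommGroup.primaryComponent W.sha 2) := Finite.of_injective _ Subtype.val_injective
  haveI : Finite (AddCommGroup.primaryComponent Wd.sha 2) := Finite.of_injective _ Subtype.val_injective
  have hdvdW : Nat.card (W.sha[(2 : ℤ)]) ∣ Nat.card (AddCommGroup.primaryComponent W.sha 2) :=
    AddSubgroup.card_dvd_of_le torsionBy_two_le_primaryComponent
  have hdvdD : Nat.card (Wd.sha[(2 : ℤ)]) ∣ Nat.card (AddCommGroup.primaryComponent Wd.sha 2) :=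
    AddSubgroup.card_dvd_of_le torsionBy_two_le_primaryComponent
  have hW0 : Nat.card (AddCommGroup.primaryComponent W.sha 2) ≠ 0 := Nat.card_pos.ne'
  have hD0' : Nat.card (AddCommGroup.primaryComponent Wd.sha 2) ≠ 0 := Nat.card_pos.ne'
  have hvW : padicValNat 2 (Nat.card (W.sha[(2 : ℤ)])) ≤ padicValNat 2 (Nat.card (AddCommGroup.primaryComponent W.sha 2)) :=
    (padicValNat_dvd_iff_le hW0).mp (dvd_trans pow_padicValNat_dvd hdvdW)
  have hvD : padicValNat 2 (Nat.card (Wd.sha[(2 : ℤ)])) ≤ padicValNat 2 (Nat.card (AddCommGroup.primaryComponent Wd.sha 2)) :=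
    (padicValNat_dvd_iff_le hD0').mp (dvd_trans pow_padicValNat_dvd hdvdD)
  -- valuations of the Selmer cardinalities
  have hshaW0 : Nat.card (W.sha[(2 : ℤ)]) ≠ 0 := fun h => hW0 (Nat.eq_zero_of_zero_dvd (h ▸ hdvdW))
  have hvselW : padicValNat 2 (Nat.card (W.selmerGroup 2)) = 1 + padicValNat 2 (Nat.card (W.sha[(2 : ℤ)])) := by
    rw [← hselW2, padicValNat.mul two_ne_zero hshaW0, padicValNat.self one_lt_two]
  have hvselD : padicValNat 2 (Nat.card (Wd.selmerGroup 2)) = padicValNat 2 (Nat.card (Wd.sha[(2 : ℤ)])) := by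
    rw [← hselD2]
  rw [hvselW, hvselD]
  omega

end Summit.BirchSwinnertonDyer.BirchSwinnertonDyer.Theorems.RankOneAtTwoOneDoor

end
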